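import Literature.NumberTheory.EllipticCurves.Monsky1990.DescentLemmaHalving
import HarnessLib

/-!
# Monsky 1990, Lemmas 5.4 and 5.8 on `E : y² = x³ − x`: the explicit `2`-descent and the point forms

Monsky, *Mock Heegner points and congruent numbers*, Math. Z. 204 (1990), pp. 59, 62–63, transports his two
descent lemmas from `C : 2Y² = X⁴ + 1` to `E : y² = x³ − x` through the `ℚ`-isomorphism `φ : C ≅ E`
(p. 62, Remarks (2): `(−1,1), (1,−1), (−1,−1) ↦ (1,0), (−1,0), (0,0)`) and reads the Galois action on a
half `A` of a point `2A = (u, ·)` off the square roots `√u, √(u + 1), √(u − 1)` ("It follows that `σ` moves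
`√u` and `√(u + 1)` while `τ` fixes `√u` and moves `√(u + 1)`", p. 62; "This amounts to showing that
`β(√u) = √u`", p. 59). The explicit square roots `ρ_e(A)` of `x(2A) − e`
and their behaviour under translation by `E[2]` and under Galois are in `DescentLemmaHalving.lean`.

Hence, if `g·A − A = T`, then `g` multiplies `√(u − e) = ρ_e(A)` by `e₂(T, (e,0))`, and the two lemmas in
field form (`DescentLemmaFields.lemma54_field`, `lemma58_field`) give the point forms `lemma54_point`
and `lemma58_point`, stated for the transfer `E_N(ℚ) → E(H)` of the tree (`Tian2014.transferE`):

* `lemma54_point` (Lemma 5.4): no `A ∈ E(H)` with `2A ∈ Λ_N` (`N ∣ 2pq`), `A^σ − A = (1, 0)`, `A^τ − A = (0, 0)`;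
* `lemma58_point` (Lemma 5.8 = 4.10): no `A ∈ E(H)` with `2A ∈ Λ_q`, `A^σ − A = (−1, 0)` (Monsky:
  `A^σ − A` is `O` or `(0, 0)`).

The degenerate case `2A ∈ E[2]` (Monsky: "If `2P ∈ T`, `P` is rational over `ℚ(i, √2)` and `P^σ = P`";
"This is clear if `2P ∈ T`") is handled by the same square-root bookkeeping (`√(u − e) ∈ {±1, ±i}`).
Everything is fully proved; no named facts.

## References

* P. Monsky, Mock Heegner points and congruent numbers, Math. Z. 204 (1990) 45–67, Lemma 4.10 (p. 59),
  Lemma 5.4 and Remarks (2) (p. 62), Lemma 5.8 (p. 63). [Monsky1990MockHeegner]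
* J. H. Silverman, *The Arithmetic of Elliptic Curves*, 2nd ed., Thm X.1.1, Prop X.1.4. [SilvermanAEC2009]
-/

noncomputable section

open scoped Classical

open WeierstrassCurve Literature.NumberTheory.EllipticCurves Literature.NumberTheory.EllipticCurves.Tian2014

namespace Literature.NumberTheory.EllipticCurves.Monsky1990

variable {H : Type} [Field H] [CharZero H]

/-! ### Unpacking `2A ∈ Λ_N` -/

/-- **`2A ∈ Λ_N` in coordinates**: if the transfer of a rational point of `E_N` is `2A`, `A = (a, b)`, `b ≠ 0`,
then `u := x(2A) = ρ₀(A)²` is rational with `u(u + 1)(u − 1) = −N v²` for a rational `v`, and `v = 0` forces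
`u ∈ {0, 1, −1}` (Monsky p. 62: "`φ : C ≈ E` maps `2P` to some `(u, iv√N)` … `u` and `v` rational";
`−Nv² = u³ − u`). [cite: Monsky1990MockHeegner, Lemma 5.4 proof (p. 62), Lemma 4.3 (p. 56)] -/
theorem exists_rat_of_transferE_eq_two_nsmul (N : ℕ) (hN0 : N ≠ 0) (θ : H)
    (hθ2 : θ ^ 2 = algebraMap ℚ H (-(N : ℚ))) (hθ : θ ≠ 0) {a b : H}
    (h : ((congruentNumberCurve 1).baseChange H).toAffine.Nonsingular a b) (hb : b ≠ 0)
    (y' : (congruentNumberCurve N).toAffine.Point)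
    (hy : transferE N θ hθ2 hθ y' = (2 : ℕ) • (Affine.Point.some a b h : EPoint H)) :
    ∃ u v : ℚ, rho 0 a b ^ 2 = (u : H) ∧ u * (u + 1) * (u - 1) = -(N : ℚ) * v ^ 2 ∧
      (v = 0 → u = 0 ∨ u = 1 ∨ u = -1) := by
  rcases y' with _ | ⟨x, y, hxy⟩
  · exfalso
    rw [show (Affine.Point.zero : (congruentNumberCurve N).toAffine.Point) = 0 from rfl, map_zero] at hy
    exact two_nsmul_some_ne_zero h hb hy.symm
  obtain ⟨h', hT⟩ := transferE_some N θ hθ2 hθ hxy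
  obtain ⟨Y, hY, h2A⟩ := exists_two_nsmul_some_eq h hb
  rw [hT, h2A] at hy
  simp only [Affine.Point.some.injEq] at hy
  obtain ⟨hx, -⟩ := hy
  have hNQ : (N : ℚ) ≠ 0 := Nat.cast_ne_zero.mpr hN0
  have hNH : (N : H) ≠ 0 := Nat.cast_ne_zero.mpr hN0
  have hθ2' : θ ^ 2 = -(N : H) := by rw [hθ2, map_neg, map_natCast]
  refine ⟨-x / N, y / N ^ 2, ?_, ?_, ?_⟩
  · rw [← hx, hθ2', eq_ratCast]
    push_cast
    field_simp
  · have hE := sq_eq_of_nonsingular_N hxy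
    have key : (-x / N) * (-x / N + 1) * (-x / N - 1) - (-(N : ℚ) * (y / N ^ 2) ^ 2) =
        (y ^ 2 - (x ^ 3 - (N : ℚ) ^ 2 * x)) / N ^ 3 := by
      field_simp
      ring
    have : (-x / N) * (-x / N + 1) * (-x / N - 1) - (-(N : ℚ) * (y / N ^ 2) ^ 2) = 0 := by
      rw [key, hE, sub_self, zero_div]
    exact sub_eq_zero.mp this
  · intro hv
    have hy0 : y = 0 := by
      rcases div_eq_zero_iff.mp hv with h0 | h0
      · exact h0
      · exact absurd (pow_eq_zero_iff two_ne_zero |>.mp h0) hNQ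
    have hE := sq_eq_of_nonsingular_N hxy
    rw [hy0, zero_pow two_ne_zero] at hE
    have hfac : x * ((x - N) * (x + N)) = 0 := by linear_combination -hE
    rcases mul_eq_zero.mp hfac with h0 | h1
    · left; rw [h0]; simp
    · rcases mul_eq_zero.mp h1 with h1 | h1
      · right; right
        rw [sub_eq_zero] at h1
        rw [h1]; field_simp
      · right; left
        rw [add_eq_zero_iff_eq_neg] at h1
        rw [h1]; field_simp

/-- A square root of `1` is fixed by every ring endomorphism (the case `2P ∈ T`: "`P` is rational over `ℚ(i, √2)` and
`P^σ = P`"). [cite: Monsky1990MockHeegner, Lemma 5.4 proof (p. 62)] -/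
private theorem map_eq_self_of_sq_eq_one (g : H →ₐ[ℚ] H) {s : H} (hs : s ^ 2 = 1) : g s = s := by
  rcases sq_eq_sq_iff_eq_or_eq_neg.mp (by rw [hs, one_pow] : s ^ 2 = 1 ^ 2) with rfl | rfl
  · exact map_one g
  · rw [map_neg, map_one]

/-- A square root of `−1` is fixed by every ring endomorphism fixing `i` (the case `2P ∈ T`).
[cite: Monsky1990MockHeegner, Lemma 5.4 proof (p. 62), Lemma 4.10 proof (p. 59)] -/
private theorem map_eq_self_of_sq_eq_neg_one (g : H →ₐ[ℚ] H) {θi : H} (hi : θi ^ 2 = -1) (hgi : g θi = θi)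
    {s : H} (hs : s ^ 2 = -1) : g s = s := by
  rcases sq_eq_sq_iff_eq_or_eq_neg.mp (hs.trans hi.symm) with rfl | rfl
  · exact hgi
  · rw [map_neg, hgi]

/-- An element fixed and negated by `g` with non-zero square: impossible ("contradicting (2)").
[cite: Monsky1990MockHeegner, Lemma 5.4 proof (p. 62)] -/
private theorem false_of_map_eq_self_of_map_eq_neg (g : H →ₐ[ℚ] H) {s c : H} (hc : c ≠ 0) (hs : s ^ 2 = c)
    (h1 : g s = s) (h2 : g s = -s) : False := by
  have : s = 0 := by
    have : (2 : H) * s = 0 := by linear_combination h2 - h1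
    rcases mul_eq_zero.mp this with h | h
    · exact absurd h two_ne_zero
    · exact h
  rw [this, zero_pow two_ne_zero] at hs
  exact hc hs.symm

/-! ### The point forms -/

/-- **The Galois action on `A = (a, b)` with `g·A − A = T`**, `T ∈ {(0,0), (1,0), (−1,0)}` (`t = 0, 1, −1`):
`g a`, `g b` are the coordinates of `A + T` (chord formulas). [cite: Monsky1990MockHeegner, Lemma 5.4 proof (p. 62)] -/
theorem map_coords_of_sub_eq (g : H ≃ₐ[ℚ] H) {a b : H}
    (h : ((congruentNumberCurve 1).baseChange H).toAffine.Nonsingular a b) (hb : b ≠ 0) {t : H}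
    (ht : ((congruentNumberCurve 1).baseChange H).toAffine.Nonsingular t 0) (ht3 : t ^ 3 = t)
    (hg : Affine.Point.map (W' := congruentNumberCurve 1) g.toAlgHom (Affine.Point.some a b h : EPoint H) -
      Affine.Point.some a b h = Affine.Point.some t 0 ht) :
    g.toAlgHom a = b ^ 2 / (a - t) ^ 2 - a - t ∧
      g.toAlgHom b = -(b / (a - t) * (b ^ 2 / (a - t) ^ 2 - a - t - a) + b) := by
  have hg' : Affine.Point.map (W' := congruentNumberCurve 1) g.toAlgHom (Affine.Point.some a b h : EPoint H) =
      Affine.Point.some a b h + Affine.Point.some t 0 ht := by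
    rw [sub_eq_iff_eq_add] at hg
    rw [hg, add_comm]
  obtain ⟨h', hadd⟩ := some_add_twoTorsion h hb ht3 ht
  rw [hadd, Affine.Point.map_some] at hg'
  simp only [Affine.Point.some.injEq] at hg'
  exact hg'

omit [CharZero H] in
/-- `a ∉ {0, 1, −1}` for a point `(a, b)` of `E` with `b ≠ 0` (the `2`-division points of `E` are `(0,0)`, `(±1,0)`).
[cite: Monsky1990MockHeegner, Remarks (2) (p. 62)] -/
private theorem ne_of_nonsingular {a b : H} (hb2 : b ^ 2 = a ^ 3 - a) (hb : b ≠ 0) :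
    a ≠ 0 ∧ a ≠ 1 ∧ a ≠ -1 := by
  refine ⟨?_, ?_, ?_⟩ <;> intro ha <;> apply hb <;> subst ha <;>
    exact pow_eq_zero_iff two_ne_zero |>.mp (by rw [hb2]; ring)

/-- **Monsky 1990, Lemma 5.4, on `E`** (point form): primes `p ≡ 5 (8)`, `q ≡ 3 (8)`, `N ∣ 2pq`; `θ = √−N`;
`σ` fixes `i, √2` and moves `√p, √q`; `τ` moves `i, √q` and fixes `√2, √p`. There is no `A ∈ E(H)` with
`2A ∈ Λ_N` (the transfer image of `E_N(ℚ)`), `A^σ − A = (1, 0)` and `A^τ − A = (0, 0)`. Monsky: "If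
`D = p₃p₅` there is no `P ∈ C` such that: (1) `2P ∈ Λ_D` or `Λ_{2D}`, (2) `P^σ − P = (−1, 1)`,
(3) `P^τ − P = (−1, −1)`" — through `φ : C ≅ E`, `(−1,1) ↦ (1,0)`, `(−1,−1) ↦ (0,0)`.
[cite: Monsky1990MockHeegner, Lemma 5.4 (p. 62), Remarks (2) (p. 62)] -/
theorem lemma54_point (σ τ : H ≃ₐ[ℚ] H) {θ₂ θp θq θi : H} {p q N : ℕ} (hp : p.Prime) (hq : q.Prime)
    (hp8 : p % 8 = 5) (hq8 : q % 8 = 3) (hN : N ∣ 2 * p * q) (hN0 : N ≠ 0)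
    (h₂ : θ₂ ^ 2 = 2) (hpθ : θp ^ 2 = p) (hqθ : θq ^ 2 = q) (hi : θi ^ 2 = -1)
    (hσ₂ : σ θ₂ = θ₂) (hσp : σ θp = -θp) (hσq : σ θq = -θq) (hσi : σ θi = θi)
    (hτ₂ : τ θ₂ = θ₂) (hτp : τ θp = θp) (hτq : τ θq = -θq) (hτi : τ θi = -θi)
    (θ : H) (hθ2 : θ ^ 2 = algebraMap ℚ H (-(N : ℚ))) (hθ : θ ≠ 0) (A : EPoint H)
    (hA : ∃ y', transferE N θ hθ2 hθ y' = (2 : ℕ) • A)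
    (hσA : Affine.Point.map (W' := congruentNumberCurve 1) σ.toAlgHom A - A = ptOne)
    (hτA : Affine.Point.map (W' := congruentNumberCurve 1) τ.toAlgHom A - A = ptZero) : False := by
  obtain ⟨y', hy⟩ := hA
  rcases A with _ | ⟨a, b, h⟩
  · -- `A = O`: `2A = O`, the transfer is `O`, but `σ·O − O = O ≠ (1, 0)`
    rw [show (Affine.Point.zero : EPoint H) = 0 from rfl, Affine.Point.map_zero, sub_zero] at hσA
    exact ptOne_ne_zero hσA.symm
  by_cases hb : b = 0
  · -- `A ∈ E[2]` is fixed by `σ`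
    subst hb
    have h2 : (2 : ℕ) • (Affine.Point.some a 0 h : EPoint H) = 0 := by
      rw [two_nsmul]
      exact Affine.Point.add_self_of_Y_eq (by rw [negY_eq, neg_zero])
    rw [map_sub_self_eq_zero_of_two_nsmul_eq_zero σ _ h2] at hσA
    exact ptOne_ne_zero hσA.symm
  have hb2 := sq_eq_of_nonsingular h
  obtain ⟨ha0, ha1, ha1'⟩ := ne_of_nonsingular hb2 hb
  obtain ⟨u, v, hu, hcubic, hv0⟩ := exists_rat_of_transferE_eq_two_nsmul N hN0 θ hθ2 hθ h hb y' hy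
  -- the three square roots
  set s₀ := rho 0 a b with hs₀def
  set s₁ := rho 1 a b with hs₁def
  set sp := rho (-1) a b with hspdef
  have hs₀ : s₀ ^ 2 = (u : H) := hu
  have hs₁ : s₁ ^ 2 = ((u - 1 : ℚ) : H) := by
    rw [hs₁def, rho_sq hb2 hb (by norm_num), hu]; push_cast; ring
  have hsp : sp ^ 2 = ((u + 1 : ℚ) : H) := by
    rw [hspdef, rho_sq hb2 hb (by norm_num), hu]; push_cast; ring
  -- the Galois signs from `σ·A = A + (1,0)`, `τ·A = A + (0,0)`
  obtain ⟨hσa, hσb⟩ := map_coords_of_sub_eq σ h hb (t := 1) (by rw [E_nonsingular_iff]; ring)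
    (by norm_num) hσA
  obtain ⟨hτa, hτb⟩ := map_coords_of_sub_eq τ h hb (t := 0) (by rw [E_nonsingular_iff]; ring)
    (by norm_num) hτA
  obtain ⟨⟨t00, t01⟩, ⟨t10, t11⟩, -⟩ := translates_eq hb2 ha0 ha1 ha1'
  obtain ⟨⟨r00, r01, r02⟩, ⟨r10, r11, r12⟩, -⟩ := rho_translates hb ha0 ha1 ha1'
  have hσ0 : σ.toAlgHom s₀ = -s₀ := by
    rw [hs₀def, ← Rat.cast_zero, ← rho_map, hσa, hσb, t11, t10, Rat.cast_zero]; exact r10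
  have hσ1 : σ.toAlgHom s₁ = s₁ := by
    rw [hs₁def, ← Rat.cast_one, ← rho_map, hσa, hσb, t11, t10, Rat.cast_one]; exact r11
  have hσ2 : σ.toAlgHom sp = -sp := by
    rw [hspdef, show (-1 : H) = ((-1 : ℚ) : H) by norm_num, ← rho_map, hσa, hσb, t11, t10]
    push_cast; exact r12
  have hτ0 : τ.toAlgHom s₀ = s₀ := by
    rw [hs₀def, ← Rat.cast_zero, ← rho_map, hτa, hτb, t01, t00, Rat.cast_zero]; exact r00
  have hτ1 : τ.toAlgHom s₁ = -s₁ := by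
    rw [hs₁def, ← Rat.cast_one, ← rho_map, hτa, hτb, t01, t00, Rat.cast_one]; exact r01
  have hτ2 : τ.toAlgHom sp = -sp := by
    rw [hspdef, show (-1 : H) = ((-1 : ℚ) : H) by norm_num, ← rho_map, hτa, hτb, t01, t00]
    push_cast; exact r02
  by_cases hv : v = 0
  · -- `2A ∈ E[2]`: `u ∈ {0, 1, −1}` and a square root in `{±1, ±i}` is moved by `σ`
    rcases hv0 hv with rfl | rfl | rfl
    · have h1 : sp ^ 2 = 1 := by rw [hsp]; push_cast; ring
      exact false_of_map_eq_self_of_map_eq_neg σ.toAlgHom one_ne_zero h1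
        (map_eq_self_of_sq_eq_one σ.toAlgHom h1) hσ2
    · have h1 : s₀ ^ 2 = 1 := by rw [hs₀]; push_cast; ring
      exact false_of_map_eq_self_of_map_eq_neg σ.toAlgHom one_ne_zero h1
        (map_eq_self_of_sq_eq_one σ.toAlgHom h1) hσ0
    · have h1 : s₀ ^ 2 = -1 := by rw [hs₀]; push_cast; ring
      exact false_of_map_eq_self_of_map_eq_neg σ.toAlgHom (neg_ne_zero.mpr one_ne_zero) h1
        (map_eq_self_of_sq_eq_neg_one σ.toAlgHom hi hσi h1) hσ0
  · exact lemma54_field σ.toAlgHom.toRingHom τ.toAlgHom.toRingHom hp hq hp8 hq8 hN hN0 h₂ hpθ hqθ hi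
      hσ₂ hσp hσq hσi hτ₂ hτp hτq hτi hv hcubic hs₀ hs₁ hsp hσ0 hσ1 hσ2 hτ0 hτ1 hτ2

/-- **Monsky 1990, Lemma 5.8 (= Lemma 4.10), on `E`** (point form): `q` an odd prime, `θ = √−q`, `σ` fixes `i, √q`
and moves `√2`. There is no `A ∈ E(H)` with `2A ∈ Λ_q` and `A^σ − A = (−1, 0)` (Monsky: "`P^σ − P` is either
`(1, 1)` or `(−1, −1)`", i.e. `O` or `(0,0)` on `E`, so never `(1, −1) ↦ (−1, 0)`).
[cite: Monsky1990MockHeegner, Lemma 5.8 (p. 63), Lemma 4.10 (p. 59), Remarks (2) (p. 62)] -/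
theorem lemma58_point (σ : H ≃ₐ[ℚ] H) {θ₂ θq θi : H} {q : ℕ} (hq : q.Prime) (hq2 : q ≠ 2)
    (h₂ : θ₂ ^ 2 = 2) (hqθ : θq ^ 2 = q) (hi : θi ^ 2 = -1)
    (hσ₂ : σ θ₂ = -θ₂) (hσq : σ θq = θq) (hσi : σ θi = θi)
    (θ : H) (hθ2 : θ ^ 2 = algebraMap ℚ H (-(q : ℚ))) (hθ : θ ≠ 0) (A : EPoint H)
    (hA : ∃ y', transferE q θ hθ2 hθ y' = (2 : ℕ) • A)
    (hσA : Affine.Point.map (W' := congruentNumberCurve 1) σ.toAlgHom A - A = ptNegOne) : False := by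
  obtain ⟨y', hy⟩ := hA
  rcases A with _ | ⟨a, b, h⟩
  · rw [show (Affine.Point.zero : EPoint H) = 0 from rfl, Affine.Point.map_zero, sub_zero] at hσA
    exact ptNegOne_ne_zero hσA.symm
  by_cases hb : b = 0
  · subst hb
    have h2 : (2 : ℕ) • (Affine.Point.some a 0 h : EPoint H) = 0 := by
      rw [two_nsmul]
      exact Affine.Point.add_self_of_Y_eq (by rw [negY_eq, neg_zero])
    rw [map_sub_self_eq_zero_of_two_nsmul_eq_zero σ _ h2] at hσA
    exact ptNegOne_ne_zero hσA.symm
  have hb2 := sq_eq_of_nonsingular h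
  obtain ⟨ha0, ha1, ha1'⟩ := ne_of_nonsingular hb2 hb
  obtain ⟨u, v, hu, hcubic, hv0⟩ := exists_rat_of_transferE_eq_two_nsmul q hq.ne_zero θ hθ2 hθ h hb y' hy
  set s₀ := rho 0 a b with hs₀def
  set s₁ := rho 1 a b with hs₁def
  have hs₀ : s₀ ^ 2 = (u : H) := hu
  have hs₁ : s₁ ^ 2 = ((u - 1 : ℚ) : H) := by
    rw [hs₁def, rho_sq hb2 hb (by norm_num), hu]; push_cast; ring
  obtain ⟨hσa, hσb⟩ := map_coords_of_sub_eq σ h hb (t := -1) (by rw [E_nonsingular_iff]; ring)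
    (by norm_num) hσA
  obtain ⟨-, -, ⟨t20, t21⟩⟩ := translates_eq hb2 ha0 ha1 ha1'
  obtain ⟨-, -, ⟨r20, r21, r22⟩⟩ := rho_translates hb ha0 ha1 ha1'
  have hσ0 : σ.toAlgHom s₀ = -s₀ := by
    rw [hs₀def, ← Rat.cast_zero, ← rho_map, hσa, hσb, t21, t20, Rat.cast_zero]; exact r20
  have hσ1 : σ.toAlgHom s₁ = -s₁ := by
    rw [hs₁def, ← Rat.cast_one, ← rho_map, hσa, hσb, t21, t20, Rat.cast_one]; exact r21
  by_cases hv : v = 0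
  · rcases hv0 hv with rfl | rfl | rfl
    · have h1 : s₁ ^ 2 = -1 := by rw [hs₁]; push_cast; ring
      exact false_of_map_eq_self_of_map_eq_neg σ.toAlgHom (neg_ne_zero.mpr one_ne_zero) h1
        (map_eq_self_of_sq_eq_neg_one σ.toAlgHom hi hσi h1) hσ1
    · have h1 : s₀ ^ 2 = 1 := by rw [hs₀]; push_cast; ring
      exact false_of_map_eq_self_of_map_eq_neg σ.toAlgHom one_ne_zero h1
        (map_eq_self_of_sq_eq_one σ.toAlgHom h1) hσ0
    · have h1 : s₀ ^ 2 = -1 := by rw [hs₀]; push_cast; ring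
      exact false_of_map_eq_self_of_map_eq_neg σ.toAlgHom (neg_ne_zero.mpr one_ne_zero) h1
        (map_eq_self_of_sq_eq_neg_one σ.toAlgHom hi hσi h1) hσ0
  · have hfix := lemma58_field σ.toAlgHom.toRingHom hq hq2 h₂ hqθ hi hσ₂ hσq hσi hv hcubic hs₀
    have hu0 : (u : H) ≠ 0 := by
      intro h0
      have : u = 0 := by exact_mod_cast h0
      rw [this] at hcubic
      simp at hcubic
      rcases hcubic with h' | h'
      · exact hq.ne_zero (by exact_mod_cast h')
      · exact hv h'
    exact false_of_map_eq_self_of_map_eq_neg σ.toAlgHom hu0 hs₀ hfix hσ0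

end Literature.NumberTheory.EllipticCurves.Monsky1990

end
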